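import Summits.QuantumFields.BalabanUV.Gaps.EndDrawdownCooperatorExtremal

/-!
# Gaps / EndDrawdownLinearCeiling — THE CEILING OF A RATE AND THE DESCENDING-STAIRCASE OBSTRUCTION: a profile-free NECESSARY condition for
# possibility on the linear road, dual to the FLOOR–ENTRY sufficient condition of `EndDrawdownLinearFloorEntry`.  Along a backward orbit `z` of the
# linear cooperator's clamped step map (`EndDrawdownCooperatorExtremal`), at a step with `b_i ≤ −ε` taken above the clamp, ABOVE the level
# `4(C∕ε)²` the help `C·ĝ_γ(z) ≤ ε∕2` loses to the rate, so `z_i ≤ max(4(C∕ε)², z_{i+1} − ε∕2)` (`backOrbit_ceiling_lin`; over a block of such steps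
# `backOrbit_block_ceiling`).  Hence the DESCENDING STAIRCASE: consecutive blocks `[i_s, i_{s+1})` (`s < T`) with `b ≤ −ε_s` on block `s`, whose
# half-depths `(i_{s+1} − i_s)·ε_s∕2` cover the ceiling gaps `4(C∕ε_{s+1})² − 4(C∕ε_s)²`, and whose last block covers the target, pin the orbit
# under the ceilings `4(C∕ε_s)²` at the block starts — below the clamp at `i_0` as soon as `4(C∕ε_0)² < 1∕γ²` (`backOrbit_below_clamp_of_staircase`).
# If such staircases exist with arbitrarily deep last block and top rate `ε_0 ≥ ε̄ > 0`, then NO forward-generated construction of the linear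
# cooperator has `EndpointExistence` (`not_endpointExistence_linCoop_of_staircase`, by DOMINATION every in-box run lies under the orbit), hence
# **`not_endPossibleLin_of_staircase`**: `¬ EndPossibleLin b C γ₀` on every box (extremality, `endPossibleLin_iff_modelOf`).  Gen 9's dyadic
# staircase `EndDrawdownLinearRoadStrict.bStair` is the model instance (its block budget `(15∕2)κ·8^t ≥ 12·4^t C²∕κ²` IS the chain condition);
# the recovering staircase of `EndDrawdownLinearRecovering` breaks every chain with one recovery step per block.  Together with the floor–entry
# condition: what row (D4)'s printed linear road reads of `β⁰` for POSSIBILITY at END grade is whether drawdown at each rate is RECOVERED before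
# drawdown at smaller rates sets in — not the size of the drawdown profile.  §3 STABILITY: domination with a summable loss
# (`backOrbit_ge_traj_perturb`) gives `endpointExistence_coop_perturb` ∕ **`endPossibleLin_perturb`** (`b′ ≥ b − δ`, `δ ≥ 0` of bounded partial
# sums ⟹ possibility passes from `b` to `b′`), `endPossibleLin_mono_seq` (more one-loop mass keeps possibility) and **`endPossibleLin_cap_free`**
# (sequences agreeing from `k₀` on are possible together: NO finite list of coefficients, no sign pattern of a prefix, is read — row CAP's
# END-grade share is NIL on the linear road for possibility too) (cell pub-balaban-gaps, seat g1-p3 GEN 10, rows CAP ∕ tail ∕ (D4)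
# «split ∕ weakening»; this seat's own leaf; file 20 of «the one-loop interface of the END statement»)

HONEST FRAMING (cell rule, page 1 of everything): [folklore] window arithmetic along backward orbits of the tree's clamped step map;
`EndPossibleLin` is a quantified READING of the cell's END-grade statement over Bałaban-free data `(b, C, γ₀)`, not a binder; the (AF-1) linear
road is a located UNPRINTED hypothesis shape ([I] (2.12)–(2.14) ∕ [II] p. 8 after (1.29); `CapSignsConstRoad` §1); NOTHING of Bałaban's table is
certified (NODE-O 0∕1, CAP coefficients 0); words ∕ odds of rows CAP ∕ tail ∕ (D4) ∕ (D1) UNCHANGED; 0∕6 binders; one finite T⁴; NOT [I] Thm 2,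
NOT `BetaPertH`, NOT the continuum limit, NOT Clay.

CITATION HEADER (tags CONTEXT ONLY).  [I] = T. Bałaban, Commun. Math. Phys. **109** (1987) 249–301 [Balaban1987RG1]: (0.20) p. 256, Thm 2
p. 259 (first sentence), (2.12)–(2.14) p. 268.
-/

namespace Summit.QuantumFields.BalabanUV.Gaps.EndDrawdownLinearCeiling

open Literature.MathematicalPhysics.QuantumFieldTheory.Balaban1983to89
open Literature.MathematicalPhysics.QuantumFieldTheory.Balaban1983to89.FlowStep
open Literature.MathematicalPhysics.QuantumFieldTheory.Balaban1983to89.FlowStepRuns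
open Literature.MathematicalPhysics.QuantumFieldTheory.Balaban1983to89.DagBinding
open Summit.QuantumFields.BalabanUV.Gaps.EndDrawdownLinearRoad
open Summit.QuantumFields.BalabanUV.Gaps.EndDrawdownCooperatorExtremal
open Summit.QuantumFields.BalabanUV.Gaps.EndRunwiseShooting (gClamp_inv_sq)
open Finset

noncomputable section

/-! ## §1 The ceiling of a rate -/

section Orbit

variable {b : ℕ → ℝ} {C γ : ℝ} {K : ℕ} {z : ℕ → ℝ}
variable (hγ : 0 < γ) (hC : 0 < C) (hz : ∀ i, i < K → stepMap b (fun x => C * x) γ i (z i) = z (i + 1))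
include hγ hC hz

/-- **THE CEILING OF A RATE** · along a backward orbit of the linear cooperator `b_k + C g_k` (`C > 0`), at a step with `b_i ≤ −ε` (`ε > 0`) taken
above the clamp (`1∕γ² ≤ z_i`): `z_i ≤ max(4(C∕ε)², z_{i+1} − ε∕2)` — above the level `4(C∕ε)²` the help `C·ĝ_γ(z_i) = C∕√z_i ≤ ε∕2` loses to the
rate.  Dual to `EndDrawdownLinearFloorEntry.backOrbit_floor_lin`. [folklore] -/
theorem backOrbit_ceiling_lin {i : ℕ} (hi : i < K) {ε : ℝ} (hε : 0 < ε) (hb : b i ≤ -ε) (hA : 1 / γ ^ 2 ≤ z i) :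
    z i ≤ max (4 * (C / ε) ^ 2) (z (i + 1) - ε / 2) := by
  by_cases hcase : z i ≤ 4 * (C / ε) ^ 2
  · exact hcase.trans (le_max_left _ _)
  · have hlt : 4 * (C / ε) ^ 2 < z i := not_le.mp hcase
    have hzpos : 0 < z i := lt_of_lt_of_le (by positivity) hA
    have hsqrt : 2 * C / ε ≤ Real.sqrt (z i) := by
      rw [← Real.sqrt_sq (show 0 ≤ 2 * C / ε by positivity)]
      exact Real.sqrt_le_sqrt (by rw [show (2 * C / ε) ^ 2 = 4 * (C / ε) ^ 2 by ring]; exact hlt.le)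
    have hhelp : C * gClamp γ (z i) ≤ ε / 2 := by
      rw [gClamp_eq_of_le hA, mul_one_div, div_le_iff₀ (Real.sqrt_pos.mpr hzpos)]
      calc C = ε / 2 * (2 * C / ε) := by field_simp
        _ ≤ ε / 2 * Real.sqrt (z i) := mul_le_mul_of_nonneg_left hsqrt (by positivity)
    have h := hz i hi
    rw [stepMap_apply] at h
    have : z i ≤ z (i + 1) - ε / 2 := by linarith
    exact this.trans (le_max_right _ _)

/-- **THE CEILING OF A BLOCK** · over a block `[k, k')` of steps with `b ≤ −ε`, all taken above the clamp (`1∕γ² ≤ z_j`, `j ≤ K`):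
`z_k ≤ max(4(C∕ε)², z_{k'} − (k' − k)·ε∕2)` — the orbit read backward either descends at half rate through the whole block or ends under the
ceiling. [folklore] -/
theorem backOrbit_block_ceiling {k k' : ℕ} (hkk' : k ≤ k') (hk' : k' ≤ K) {ε : ℝ} (hε : 0 < ε)
    (hb : ∀ j, k ≤ j → j < k' → b j ≤ -ε) (hA : ∀ j, j ≤ K → 1 / γ ^ 2 ≤ z j) :
    z k ≤ max (4 * (C / ε) ^ 2) (z k' - ((k' - k : ℕ) : ℝ) * (ε / 2)) := by
  suffices h : ∀ d j, j + d = k' → k ≤ j → z j ≤ max (4 * (C / ε) ^ 2) (z k' - (d : ℝ) * (ε / 2)) by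
    have := h (k' - k) k (by omega) le_rfl
    simpa using this
  intro d
  induction d with
  | zero => intro j hj _; rw [show j = k' by omega]; simp
  | succ d ih =>
    intro j hj hkj
    have hjK : j < K := by omega
    have h1 := backOrbit_ceiling_lin hγ hC hz hjK hε (hb j hkj (by omega)) (hA j hjK.le)
    have h2 := ih (j + 1) (by omega) (by omega)
    rcases le_max_iff.mp h1 with h1 | h1
    · exact h1.trans (le_max_left _ _)
    · rcases le_max_iff.mp h2 with h2 | h2
      · have hε2 : 0 < ε / 2 := by positivity
        exact le_max_iff.mpr (Or.inl (by linarith))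
      · refine le_max_iff.mpr (Or.inr ?_)
        have : ((d + 1 : ℕ) : ℝ) = (d : ℝ) + 1 := by push_cast; ring
        rw [this]
        linarith

/-- **THE DESCENDING STAIRCASE PINS THE ORBIT BELOW THE CLAMP** · consecutive blocks `[i_s, i_{s+1})`, `s < T` (`T ≥ 1`, `i_T = K`), with
`b ≤ −ε_s` on block `s` (`ε_s > 0`), half-depths covering the ceiling gaps (`4(C∕ε_{s+1})² − 4(C∕ε_s)² ≤ (i_{s+1} − i_s)·ε_s∕2`), the last block
covering the target (`z_K − 4(C∕ε_{T−1})² ≤ (i_T − i_{T−1})·ε_{T−1}∕2`) and the top ceiling under the clamp (`4(C∕ε_0)² < 1∕γ²`): the orbit is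
below the clamp somewhere on `[0, K]` (else, by the block ceilings, `z_{i_s} ≤ 4(C∕ε_s)²` for every `s`, down to `z_{i_0} < 1∕γ²`). [folklore] -/
theorem backOrbit_below_clamp_of_staircase {T : ℕ} (hT : 1 ≤ T) {idx : ℕ → ℕ} {ε : ℕ → ℝ}
    (hmono : ∀ s, s < T → idx s ≤ idx (s + 1)) (hKT : idx T = K) (hε : ∀ s, s < T → 0 < ε s)
    (hb : ∀ s, s < T → ∀ j, idx s ≤ j → j < idx (s + 1) → b j ≤ -ε s)
    (hchain : ∀ s, s + 1 < T → 4 * (C / ε (s + 1)) ^ 2 - 4 * (C / ε s) ^ 2 ≤ ((idx (s + 1) - idx s : ℕ) : ℝ) * (ε s / 2))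
    (hlast : z K - 4 * (C / ε (T - 1)) ^ 2 ≤ ((idx T - idx (T - 1) : ℕ) : ℝ) * (ε (T - 1) / 2))
    (htop : 4 * (C / ε 0) ^ 2 < 1 / γ ^ 2) : ∃ i, i ≤ K ∧ z i < 1 / γ ^ 2 := by
  by_contra hneg
  have hcon : ∀ i, i ≤ K → 1 / γ ^ 2 ≤ z i := fun i hi => not_lt.mp fun hlt => hneg ⟨i, hi, hlt⟩
  have hidx : ∀ s, s ≤ T → idx s ≤ K := by
    suffices h : ∀ d s, s + d = T → idx s ≤ idx T from fun s hs => (h (T - s) s (by omega)).trans_eq hKT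
    intro d
    induction d with
    | zero => intro s hs; rw [show s = T by omega]
    | succ d ih => intro s hs; exact (hmono s (by omega)).trans (ih (s + 1) (by omega))
  -- the block starts are pinned under the ceilings, from the last block down to block 0
  have hpin : ∀ d s, s + d + 1 = T → z (idx s) ≤ 4 * (C / ε s) ^ 2 := by
    intro d
    induction d with
    | zero =>
      intro s hs
      have hsT : s = T - 1 := by omega
      have h := backOrbit_block_ceiling hγ hC hz (hmono s (by omega)) (hidx (s + 1) (by omega)) (hε s (by omega))
        (hb s (by omega)) hcon
      rw [show s + 1 = T by omega] at h
      have hl := hlast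
      rw [← hKT] at hl
      subst hsT
      rcases le_max_iff.mp h with h | h
      · exact h
      · linarith
    | succ d ih =>
      intro s hs
      have h := backOrbit_block_ceiling hγ hC hz (hmono s (by omega)) (hidx (s + 1) (by omega)) (hε s (by omega)) (hb s (by omega)) hcon
      have hnext := ih (s + 1) (by omega)
      have hc := hchain s (by omega)
      rcases le_max_iff.mp h with h | h
      · exact h
      · linarith
  have h0 := hpin (T - 1) 0 (by omega)
  have hA0 := hcon (idx 0) (hidx 0 (Nat.zero_le T))
  linarith

end Orbit

/-! ## §2 The obstruction at END grade -/

section Headline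

variable {b : ℕ → ℝ} {C : ℝ}

/-- **THE DESCENDING-STAIRCASE OBSTRUCTION** · if for every depth `D` the one-loop sequence `b` contains a descending staircase — consecutive
blocks `[i_s, i_{s+1})`, `s < T`, with `b ≤ −ε_s` on block `s`, top rate `ε_0 ≥ ε̄ > 0`, half-depths covering the ceiling gaps
`4(C∕ε_{s+1})² − 4(C∕ε_s)²`, and last half-depth `≥ D` — then NO forward-generated construction of the linear cooperator `b_k + C g_k` has
`EndpointExistence` (`C > 0`): at the box `γ = γ₂ ∧ ε̄∕(4C)` and the target `g⋆`, the staircase of depth `1∕g⋆²` ending at `K = i_T` pins the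
backward orbit below the clamp, while DOMINATION (`EndDrawdownCooperatorExtremal.backOrbit_ge_traj`) keeps every in-box run under the orbit.
[cite: Balaban1987RG1, Thm 2 p.259 (first sentence) and (0.20) p.256] -/
theorem not_endpointExistence_linCoop_of_staircase (hC : 0 < C) {εbar : ℝ} (hεbar : 0 < εbar)
    (h : ∀ D : ℝ, ∃ (T : ℕ) (idx : ℕ → ℕ) (ε : ℕ → ℝ), 1 ≤ T ∧ (∀ s, s < T → idx s ≤ idx (s + 1)) ∧ (∀ s, s < T → 0 < ε s) ∧
      εbar ≤ ε 0 ∧ (∀ s, s < T → ∀ j, idx s ≤ j → j < idx (s + 1) → b j ≤ -ε s) ∧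
      (∀ s, s + 1 < T → 4 * (C / ε (s + 1)) ^ 2 - 4 * (C / ε s) ^ 2 ≤ ((idx (s + 1) - idx s : ℕ) : ℝ) * (ε s / 2)) ∧
      D ≤ ((idx T - idx (T - 1) : ℕ) : ℝ) * (ε (T - 1) / 2))
    {β : HBeta} (hβ : ∀ (k : ℕ) (p : Fin (k + 1) → ℝ), 0 < p (Fin.last k) → β k p = b k + C * p (Fin.last k))
    {Cn : B12.Construction} (hgen : ForwardGenerated Cn β) : ¬ EndpointExistence Cn := by
  intro hE
  obtain ⟨γ₂, hγ₂, hγ⟩ := hE 0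
  set γ : ℝ := min γ₂ (εbar / (4 * C)) with hγdef
  have hγpos : 0 < γ := lt_min hγ₂ (by positivity)
  have hγtop : γ ≤ εbar / (4 * C) := min_le_right _ _
  obtain ⟨gstar, hgstar, hg⟩ := hγ γ hγpos (min_le_left _ _)
  obtain ⟨T, idx, ε, hT, hmono, hε, hε0, hb, hchain, hlast⟩ := h (1 / gstar ^ 2)
  obtain ⟨g0, hI, hKend⟩ := hg gstar hgstar le_rfl (idx T)
  obtain ⟨z, hzK, hz⟩ := exists_backOrbit (b := b) (H := fun x => C * x) hγpos (continuousOn_linHelp C γ)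
    (monotoneOn_linHelp hC.le γ) (idx T) (1 / gstar ^ 2)
  have hdom := backOrbit_ge_traj hγpos (monotoneOn_linHelp hC.le γ) hI
    (steps_dominated_of_coopRun (H := fun x => C * x) hβ hgen ⟨idx T, 0, g0⟩ hI) (by rw [hzK]; exact le_of_eq (by rw [hKend])) hz
  have hall : ∀ i, i ≤ idx T → 1 / γ ^ 2 ≤ z i := fun i hi =>
    (one_div_le_one_div_of_le (pow_pos (hI i hi).1 2) (pow_le_pow_left₀ (hI i hi).1.le (hI i hi).2 2)).trans (hdom i hi)
  have htop : 4 * (C / ε 0) ^ 2 < 1 / γ ^ 2 := by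
    have h1 : 4 * (C / ε 0) ^ 2 ≤ 4 * (C / εbar) ^ 2 := by
      have := div_le_div_of_nonneg_left hC.le hεbar hε0
      nlinarith [div_nonneg hC.le (hεbar.le.trans hε0)]
    have h2 : (1 / γ) ^ 2 ≥ (4 * C / εbar) ^ 2 := by
      have h3 : 4 * C / εbar ≤ 1 / γ := by
        rw [div_le_div_iff₀ hεbar hγpos, one_mul]
        have := (le_div_iff₀ (by positivity : (0 : ℝ) < 4 * C)).mp hγtop
        linarith
      exact pow_le_pow_left₀ (by positivity) h3 2
    have h4 : 4 * (C / εbar) ^ 2 < (4 * C / εbar) ^ 2 := by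
      have hq : 0 < (C / εbar) ^ 2 := by positivity
      have e : (4 * C / εbar) ^ 2 = 16 * (C / εbar) ^ 2 := by ring
      rw [e]; linarith
    have e1 : (1 / γ) ^ 2 = 1 / γ ^ 2 := by ring
    linarith
  have hlast' : z (idx T) - 4 * (C / ε (T - 1)) ^ 2 ≤ ((idx T - idx (T - 1) : ℕ) : ℝ) * (ε (T - 1) / 2) := by
    rw [hzK]
    have : 0 ≤ 4 * (C / ε (T - 1)) ^ 2 := by positivity
    linarith
  obtain ⟨i, hi, hlt⟩ := backOrbit_below_clamp_of_staircase (K := idx T) hγpos hC hz hT hmono rfl hε hb hchain hlast' htop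
  exact absurd (hall i hi) (not_le.mpr hlt)

/-- **… HENCE IMPOSSIBLE ON THE LINEAR ROAD** (`C > 0`, every box): the linear cooperator is extremal
(`EndDrawdownCooperatorExtremal.endPossibleLin_iff_modelOf`). [cite: Balaban1987RG1, Thm 2 p.259 (first sentence) and (2.12)–(2.14) p.268] -/
theorem not_endPossibleLin_of_staircase (hC : 0 < C) {εbar : ℝ} (hεbar : 0 < εbar)
    (h : ∀ D : ℝ, ∃ (T : ℕ) (idx : ℕ → ℕ) (ε : ℕ → ℝ), 1 ≤ T ∧ (∀ s, s < T → idx s ≤ idx (s + 1)) ∧ (∀ s, s < T → 0 < ε s) ∧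
      εbar ≤ ε 0 ∧ (∀ s, s < T → ∀ j, idx s ≤ j → j < idx (s + 1) → b j ≤ -ε s) ∧
      (∀ s, s + 1 < T → 4 * (C / ε (s + 1)) ^ 2 - 4 * (C / ε s) ^ 2 ≤ ((idx (s + 1) - idx s : ℕ) : ℝ) * (ε s / 2)) ∧
      D ≤ ((idx T - idx (T - 1) : ℕ) : ℝ) * (ε (T - 1) / 2))
    {γ₀ : ℝ} (hγ₀ : 0 < γ₀) : ¬ EndPossibleLin b C γ₀ := fun hP =>
  not_endpointExistence_linCoop_of_staircase hC hεbar h (fun k _ hp => betaLin_of_pos b C k hp) (modelOf_forwardGenerated _)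
    ((endPossibleLin_iff_modelOf hC.le hγ₀).mp hP)

end Headline

/-! ## §3 Stability: more one-loop mass, summable losses and finitely many coefficients do not change possibility -/

section Stability

variable {b b' : ℕ → ℝ} {H : ℝ → ℝ} {γ : ℝ} {K : ℕ}

/-- **DOMINATION WITH A SUMMABLE LOSS** · a positive trajectory `g'` in `]0,γ]` with steps dominated by the cooperator of `b`
(`1∕g'_i² − 1∕g'_{i+1}² ≤ b_i + H(g'_i)`), a second one-loop sequence `b'' ≥ b − δ` with `δ ≥ 0`, and a backward orbit `z` of the cooperator of
`b''` with `1∕g'_K² ≤ z_K`: then `1∕g'_i² − Σ_{[i,K)} δ ≤ z_i` (`i ≤ K`) — the orbit of the perturbed cooperator loses at most the accumulated `δ`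
(generalizes `EndDrawdownCooperatorExtremal.backOrbit_ge_traj`, the case `δ = 0`; `H` non-decreasing on `]0,γ]`). [folklore] -/
theorem backOrbit_ge_traj_perturb (hγ : 0 < γ) (hHm : MonotoneOn H (Set.Ioc 0 γ)) {g' : ℕ → ℝ}
    (hI : ∀ i, i ≤ K → 0 < g' i ∧ g' i ≤ γ) (hstep : ∀ i, i < K → 1 / (g' i) ^ 2 - 1 / (g' (i + 1)) ^ 2 ≤ b i + H (g' i))
    {δ : ℕ → ℝ} (hδ : ∀ j, 0 ≤ δ j) (hle : ∀ j, b j - δ j ≤ b' j)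
    {z : ℕ → ℝ} (hzK : 1 / (g' K) ^ 2 ≤ z K) (hz : ∀ i, i < K → stepMap b' H γ i (z i) = z (i + 1)) :
    ∀ i, i ≤ K → 1 / (g' i) ^ 2 - ∑ j ∈ Ico i K, δ j ≤ z i := by
  suffices h : ∀ d i, i + d = K → 1 / (g' i) ^ 2 - ∑ j ∈ Ico i K, δ j ≤ z i from fun i hi => h (K - i) i (by omega)
  intro d
  induction d with
  | zero => intro i hi; rw [show i = K by omega]; simpa using hzK
  | succ d ih =>
    intro i hi
    have hiK : i < K := by omega
    have ih' := ih (i + 1) (by omega)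
    rw [Finset.sum_eq_sum_Ico_succ_bot hiK]
    by_cases hcase : 1 / (g' i) ^ 2 ≤ z i
    · have hs : 0 ≤ ∑ j ∈ Ico (i + 1) K, δ j := Finset.sum_nonneg fun j _ => hδ j
      linarith [hδ i]
    · have hlt : z i ≤ 1 / (g' i) ^ 2 := (not_le.mp hcase).le
      have hanti := help_antitone (H := H) hγ hHm hlt
      have hgi : gClamp γ (1 / (g' i) ^ 2) = g' i := gClamp_inv_sq (hI i hiK.le).1 (hI i hiK.le).2
      have h := hz i hiK
      rw [stepMap_apply] at h
      have h1 : H (g' i) ≤ H (gClamp γ (z i)) := by rw [← hgi]; exact hanti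
      linarith [hstep i hiK, hle i]

/-- **STABILITY OF E UNDER SUMMABLE LOSSES** · `H` continuous and non-decreasing on `]0,γ₀]`; if SOME forward-generated construction of the
cooperator of `b` has `EndpointExistence` and `b' ≥ b − δ` with `δ ≥ 0` of bounded partial sums (`Σ_{j<n} δ ≤ D`), then EVERY forward-generated
construction of the cooperator of `b'` has it (shrink the box to `1∕γ'² = 1∕γ² + D`: the runs of `b`'s cooperator there, read through the perturbed
orbit, stay in `]0,γ]`).  More one-loop mass (`δ = 0`), summable losses, finitely many changed coefficients: possibility is unchanged.
[cite: Balaban1987RG1, Thm 2 p.259 (first sentence) and (0.20) p.256] -/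
theorem endpointExistence_coop_perturb {γ₀ : ℝ} (hγ₀ : 0 < γ₀) (hHc : ContinuousOn H (Set.Ioc 0 γ₀)) (hHm : MonotoneOn H (Set.Ioc 0 γ₀))
    {δ : ℕ → ℝ} (hδ : ∀ j, 0 ≤ δ j) {D : ℝ} (hD : ∀ n, ∑ j ∈ range n, δ j ≤ D) (hle : ∀ j, b j - δ j ≤ b' j)
    {β : HBeta} (hβ : ∀ (k : ℕ) (p : Fin (k + 1) → ℝ), 0 < p (Fin.last k) → β k p = b k + H (p (Fin.last k)))
    {C₁ : B12.Construction} (hgen₁ : ForwardGenerated C₁ β) (hE₁ : EndpointExistence C₁)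
    {β' : HBeta} (hβ' : ∀ (k : ℕ) (p : Fin (k + 1) → ℝ), 0 < p (Fin.last k) → β' k p = b' k + H (p (Fin.last k)))
    {C : B12.Construction} (hgen : ForwardGenerated C β') : EndpointExistence C := by
  have hD0 : 0 ≤ D := by simpa using hD 0
  intro m
  obtain ⟨γ₂, hγ₂, h⟩ := hE₁ m
  refine ⟨min γ₂ γ₀, lt_min hγ₂ hγ₀, fun γ hγ hγle => ?_⟩
  have hγγ₀ : γ ≤ γ₀ := hγle.trans (min_le_right _ _)
  set γ' : ℝ := 1 / Real.sqrt (1 / γ ^ 2 + D) with hγ'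
  have hApos : 0 < 1 / γ ^ 2 + D := by positivity
  have hγ'pos : 0 < γ' := by positivity
  have hγ'sq : 1 / γ' ^ 2 = 1 / γ ^ 2 + D := by
    rw [hγ', div_pow, one_pow, Real.sq_sqrt hApos.le, one_div_one_div]
  have hγ'le : γ' ≤ γ := by
    have h1 : 1 / γ ^ 2 ≤ 1 / γ' ^ 2 := by rw [hγ'sq]; linarith
    have h2 : γ' ^ 2 ≤ γ ^ 2 := (one_div_le_one_div (pow_pos hγ 2) (pow_pos hγ'pos 2)).mp h1
    exact (pow_le_pow_iff_left₀ hγ'pos.le hγ.le two_ne_zero).mp h2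
  obtain ⟨gstar, hgstar, hg⟩ := h γ' hγ'pos (hγ'le.trans (hγle.trans (min_le_left _ _)))
  refine ⟨gstar, hgstar, fun g hg0 hgle K => ?_⟩
  obtain ⟨g0', hI', hK'⟩ := hg g hg0 hgle K
  have hsub : Set.Ioc 0 γ ⊆ Set.Ioc 0 γ₀ := fun x hx => ⟨hx.1, hx.2.trans hγγ₀⟩
  have hIγ : (C₁ ⟨K, m, g0'⟩).flow.InInterval γ K := fun i hi => ⟨(hI' i hi).1, (hI' i hi).2.trans hγ'le⟩
  have hsteps := steps_dominated_of_coopRun (γ := γ') hβ hgen₁ ⟨K, m, g0'⟩ hI'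
  obtain ⟨z, hzK, hz⟩ := exists_backOrbit (b := b') hγ (hHc.mono hsub) (hHm.mono hsub) K (1 / g ^ 2)
  have hpert := backOrbit_ge_traj_perturb (K := K) hγ (hHm.mono hsub) hIγ hsteps hδ hle (by rw [hzK, hK']) hz
  have hA : ∀ i, i ≤ K → 1 / γ ^ 2 ≤ z i := by
    intro i hi
    have h1 := hpert i hi
    have h2 : 1 / γ' ^ 2 ≤ 1 / ((C₁ ⟨K, m, g0'⟩).flow.g i) ^ 2 :=
      one_div_le_one_div_of_le (pow_pos (hI' i hi).1 2) (pow_le_pow_left₀ (hI' i hi).1.le (hI' i hi).2 2)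
    have h3 : ∑ j ∈ Ico i K, δ j ≤ D :=
      (Finset.sum_le_sum_of_subset_of_nonneg (Finset.Ico_subset_Iio_self.trans_eq (Nat.Iio_eq_range K))
        (fun j _ _ => hδ j)).trans (hD K)
    linarith
  have hgγ : g ≤ γ := by rw [← hK']; exact ((hI' K le_rfl).2).trans hγ'le
  obtain ⟨g0, hI0, hK0, -⟩ := run_of_backOrbit hβ' hγ hgen hg0 hgγ m hzK hz hA
  exact ⟨g0, hI0, hK0⟩

variable {C γ₀ : ℝ}

/-- **ON THE LINEAR ROAD: POSSIBILITY IS STABLE UNDER SUMMABLE LOSSES** (`0 ≤ C`, `0 < γ₀`): `b' ≥ b − δ`, `δ ≥ 0`, `Σ_{j<n} δ ≤ D` ⟹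
(`EndPossibleLin b C γ₀ ⟹ EndPossibleLin b' C γ₀`). [cite: Balaban1987RG1, Thm 2 p.259 (first sentence) and (2.12)–(2.14) p.268] -/
theorem endPossibleLin_perturb (hC : 0 ≤ C) (hγ₀ : 0 < γ₀) {δ : ℕ → ℝ} (hδ : ∀ j, 0 ≤ δ j) {D : ℝ} (hD : ∀ n, ∑ j ∈ range n, δ j ≤ D)
    (hle : ∀ j, b j - δ j ≤ b' j) (h : EndPossibleLin b C γ₀) : EndPossibleLin b' C γ₀ :=
  (endPossibleLin_iff_modelOf hC hγ₀).mpr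
    (endpointExistence_coop_perturb (H := fun x => C * x) hγ₀ (continuousOn_linHelp C γ₀) (monotoneOn_linHelp hC γ₀) hδ hD hle
      (fun k _ hp => betaLin_of_pos b C k hp) (modelOf_forwardGenerated _) ((endPossibleLin_iff_modelOf hC hγ₀).mp h)
      (fun k _ hp => betaLin_of_pos b' C k hp) (modelOf_forwardGenerated _))

/-- **MONOTONE IN THE ONE-LOOP PART** · `b ≤ b'` pointwise ⟹ (`EndPossibleLin b C γ₀ ⟹ EndPossibleLin b' C γ₀`) (`0 ≤ C`, `0 < γ₀`). [folklore] -/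
theorem endPossibleLin_mono_seq (hC : 0 ≤ C) (hγ₀ : 0 < γ₀) (hle : ∀ j, b j ≤ b' j) (h : EndPossibleLin b C γ₀) : EndPossibleLin b' C γ₀ :=
  endPossibleLin_perturb hC hγ₀ (δ := fun _ => 0) (fun _ => le_rfl) (D := 0) (fun n => by simp) (fun j => by linarith [hle j]) h

/-- **CAP-FREE** · two one-loop sequences agreeing from `k₀` on are possible on the linear road together: NO finite list of coefficients (in
particular no sign pattern of the first `k₀`) is read by possibility on the linear road (`0 ≤ C`, `0 < γ₀`; cf. `EndDrawdownEverySlopeDecided.everySlope_cap_free`).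
[cite: Balaban1987RG1, Thm 2 p.259 (first sentence) and (2.12)–(2.14) p.268] -/
theorem endPossibleLin_cap_free (hC : 0 ≤ C) (hγ₀ : 0 < γ₀) {k₀ : ℕ} (heq : ∀ j, k₀ ≤ j → b' j = b j) :
    EndPossibleLin b C γ₀ ↔ EndPossibleLin b' C γ₀ := by
  have key : ∀ {u v : ℕ → ℝ}, (∀ j, k₀ ≤ j → v j = u j) → EndPossibleLin u C γ₀ → EndPossibleLin v C γ₀ := by
    intro u v huv h
    refine endPossibleLin_perturb hC hγ₀ (δ := fun j => if j < k₀ then |u j - v j| else 0)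
      (fun j => by split_ifs <;> positivity) (D := ∑ j ∈ range k₀, |u j - v j|) (fun n => ?_) (fun j => ?_) h
    · calc ∑ j ∈ range n, (if j < k₀ then |u j - v j| else 0)
          = ∑ j ∈ (range n).filter (fun j => j < k₀), |u j - v j| := by rw [Finset.sum_filter]
        _ ≤ ∑ j ∈ range k₀, |u j - v j| :=
          Finset.sum_le_sum_of_subset_of_nonneg (fun j hj => by simp only [mem_filter, mem_range] at hj ⊢; exact hj.2)
            fun _ _ _ => abs_nonneg _
    · by_cases hj : j < k₀
      · rw [if_pos hj]; linarith [le_abs_self (u j - v j)]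
      · rw [if_neg hj, huv j (not_lt.mp hj)]; simp
  exact ⟨key heq, key fun j hj => (heq j hj).symm⟩

end Stability

/-! ## §4 (v1.1, appended; §§1–3 and the header byte-identical to v1) The parametrised ceiling and the joint step — the general tools consumed by
`EndDrawdownLinearPartialRecovery` (ceiling–chains with one joint step per block): above the level `m²(C∕ε)²` the help is `≤ ε∕m`, so rate steps
descend at `(1 − 1∕m)ε` read backward (`m = 2` is §1's ceiling); at ANY step the help is at most `C·γ`. -/

section JointTools

variable {b : ℕ → ℝ} {C γ : ℝ} {K : ℕ} {z : ℕ → ℝ}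
variable (hγ : 0 < γ) (hC : 0 < C) (hz : ∀ i, i < K → stepMap b (fun x => C * x) γ i (z i) = z (i + 1))
include hγ hC hz

/-- **THE PARAMETRISED CEILING** (`m ≥ 1`) · at a step with `b_i ≤ −ε` taken above the clamp: `z_i ≤ max(m²(C∕ε)², z_{i+1} − (1 − 1∕m)ε)` — above the
level `m²(C∕ε)²` the help `C∕√z_i ≤ ε∕m`. (`m = 2`: `backOrbit_ceiling_lin` of §1.) [folklore] -/
theorem backOrbit_ceiling_lin_m {m : ℝ} (hm : 1 ≤ m) {i : ℕ} (hi : i < K) {ε : ℝ} (hε : 0 < ε) (hb : b i ≤ -ε) (hA : 1 / γ ^ 2 ≤ z i) :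
    z i ≤ max (m ^ 2 * (C / ε) ^ 2) (z (i + 1) - (1 - 1 / m) * ε) := by
  by_cases hcase : z i ≤ m ^ 2 * (C / ε) ^ 2
  · exact hcase.trans (le_max_left _ _)
  · have hlt : m ^ 2 * (C / ε) ^ 2 < z i := not_le.mp hcase
    have hzpos : 0 < z i := lt_of_lt_of_le (by positivity) hA
    have hsqrt : m * C / ε ≤ Real.sqrt (z i) := by
      rw [← Real.sqrt_sq (show 0 ≤ m * C / ε by positivity)]
      exact Real.sqrt_le_sqrt (by rw [show (m * C / ε) ^ 2 = m ^ 2 * (C / ε) ^ 2 by ring]; exact hlt.le)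
    have hhelp : C * gClamp γ (z i) ≤ ε / m := by
      rw [gClamp_eq_of_le hA, mul_one_div, div_le_iff₀ (Real.sqrt_pos.mpr hzpos)]
      calc C = ε / m * (m * C / ε) := by field_simp
        _ ≤ ε / m * Real.sqrt (z i) := mul_le_mul_of_nonneg_left hsqrt (by positivity)
    have h := hz i hi
    rw [stepMap_apply] at h
    have e : (1 - 1 / m) * ε = ε - ε / m := by ring
    have : z i ≤ z (i + 1) - (1 - 1 / m) * ε := by rw [e]; linarith
    exact this.trans (le_max_right _ _)

/-- **THE JOINT STEP** · at ANY step: `z_i ≤ z_{i+1} + b_i + Cγ` (the help is at most `C·γ`). [folklore] -/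
theorem backOrbit_joint_le {i : ℕ} (hi : i < K) : z i ≤ z (i + 1) + b i + C * γ := by
  have h := hz i hi
  rw [stepMap_apply] at h
  have := mul_le_mul_of_nonneg_left (gClamp_le hγ (z i)) hC.le
  linarith

end JointTools

end

end Summit.QuantumFields.BalabanUV.Gaps.EndDrawdownLinearCeiling
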